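import Summits.BirchSwinnertonDyer.BirchSwinnertonDyer.Theorems.UniversalToricDescentTwinHowardRank
import Literature.NumberTheory.EllipticCurves.LambdaAdicSelmerDataEisensteinNotDivisibleProofs
import HarnessLib

/-!
# The BOUNDED-INDEX glue: Howard's conclusion at the control levels of a class `z` whose control images are NOT
# `T^j`-divisible ⟹ `#(X_tors ⧸ q_m X_tors) ≤ p^C` UNIFORMLY in `m` — with NO hypothesis on the `Λ`-adic Selmer module `𝔖`
# (no finite generation, no rank one, no `𝔖 ⧸ Λz` torsion, no freeness)

Summits-side helper toward crux r205 stmt-BirchSwinnertonDyer-24737 `…Theses.UniversalToricDescent.TwinAlgMuZeroAtThree`, line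
`beta-road` (LEAD lineage `bsd-wall-utd-p1`, g27; `--supports`).  ROUTE-INDEPENDENT; THEOREMS ONLY (no definition, no letter, no
named fact, no instance, no `sorry`).

WHY.  Skeleton v11 of the line split Howard's machine for the twin into K2a (a Kolyvagin system ⟹ `Stmt.conclusionAtControlLevels`)
and K2b `stub_cyclicSpecializationOfConclusion` («`𝔖/q_m𝔖` cyclic for one `m`» = FREENESS of `𝔖 = 𝔖_3(E′/K_∞)`, i.e. the KERNEL of
Howard's compact control map `𝔖/q_m𝔖 → H¹_{F_𝔮}(K, T_𝔮)`, Prop. 2.2.8 first map — whose proof needs the ambient `H¹(K, 𝐓)`, absent from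
the tree; Howard's own Thm. 2.2.10 (arXiv 3.2.10) proves «torsion-free of rank one», not freeness).  K2b was only used to turn K1's
«`z ∉ 3𝔖`» into `μ(𝔖/Λz) = 0` for the (H-iii) index inequality `#(X_tors/q_m) ≤ 3^{C′}·#((𝔖/Λz)/q_m)²`.  THIS FILE removes the detour:
K1 gives directly that the control image `f_m z ∈ H¹(K, T_{q_m})` is not in `T^{p^k}·H¹(K, T_{q_m})` for every `m ≥ p^k`
(`LambdaAdicSelmerData.toEisensteinH1Linear_not_mem_X_pow_smul_top`, p655750, from `(proj_k z)_1 ≠ 0`); with Conclusion (i)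
(`H_m := H¹_{F_𝔮}(K, T_𝔮)` free of rank one over the DVR `S_m`) the index `#(H_m / S_m·f_m z)` is `≤ p^{p^k}`, BOUNDED in `m`; so
x9's `SpecWitness` can be built on the FREE RANK-ONE FRAME `S := Λ`, `L := ⊤`, `f := (r ↦ r • f̂_m z)` (cokernel `= H_m/S_m f̂_m z`),
and x9's `exists_card_bound_of_specWitnesses` yields `#(X_tors/q_m X_tors) ≤ p^{C}·#((Λ/⊤)/q_m)² = p^C`.  Howard's (iii)
`length M ≤ length(S_m/r₁)` is consumed at `r₁ = ` the `S_m`-coordinate of `f̂_m z`, exactly as in print (Thm. 2.2.10's proof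
bounds `M` by the index of `κ₁` in `H¹_{F_𝔮}(K, T_𝔮)`, never by an index inside `𝔖`).

WHAT.
* the NON-DIVISIBILITY HYPOTHESIS `hndiv` (spelled out, no letter): for every `m ≥ j` (`m ≥ 1`), every transition datum and
  every pin `I` of `H¹(K, T_{q_m})`, `f_m z = toEisensteinH1Linear … z ∉ T^j • H¹(K, T_{q_m})` (at `j = p^k` this is the OUTPUT of
  p655750 from `(proj_k z)_1 ≠ 0`, which K1 supplies for the `Λ`-adic Heegner class — companion file
  `UniversalToricDescentTwinK2ResOfConclusion`).
* **`hasSpecWitnesses_top_of_conclusion_of_notDivisible`** — (B5) at `p` (`Stmt.readoutIndexMultAt p`; (B4) is the theorem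
  `readoutSelmerMultAt_holds p`) + `hndiv` + `Stmt.conclusionAtControlLevels p … D z` ⟹
  `HasSpecWitnesses p Λ X.X ⊤` (x10b's `controlGlueMultAt_of_clauses` VERBATIM on the discrete side; compact side as above).
* **`exists_natCard_torsion_quot_le_of_conclusion_of_notDivisible`** — ⟹ `∃ C m₀, ∀ m ≥ m₀, #(X_tors ⧸ q_m X_tors) ≤ p^C`.
* **`twin_natCard_torsion_quot_le_of_conclusion_of_notDivisible`** — the twin at `p = 3` in the binders of crux 24737
  (`Rank1Residual.Mult W′ 3`, `ρ̄₃` onto, `K` imaginary quadratic Heegner, `κ` anticyclotomic; (B5) = `readoutIndexMultAt_three`,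
  p765199): the same bound for `X = (W′.baseChange K).selmerDualData κ hγ`, unconditionally in the glue.
What this is NOT: the Kolyvagin system / Howard's conclusion for the twin (K2a, beyond print at `p = 3`, `3 ∥ N′`), K1, C₀.
No summit statement is proved; BSD is not proved by any of this.

References: [Howard2004HeegnerKolyvagin] Thm. 1.6.1, Prop. 2.2.8 and proof of Thm. 2.2.10 (𝔮 = T^m + p; arXiv:1202.6340 Thm. 2.6.1,
Prop. 3.2.8, Thm. 3.2.10 p. 17); [GreenbergLNM1716] §4 p. 98; [MazurRubinMemoirs2004] Prop. 5.3.14; [MastellaZerman2026] Thm. 2.40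
(shape of the witness).
-/

set_option linter.dupNamespace false
set_option autoImplicit false

noncomputable section

open scoped Classical Pointwise ContRepresentation TensorProduct NumberField

open Function NumberField IsDedekindDomain Field
open Literature Literature.NumberTheory.EllipticCurves WeierstrassCurve
open Literature.NumberTheory.GaloisCohomology Literature.NumberTheory.GaloisCohomology.Howard2004
open Literature.NumberTheory.GaloisRepresentations Literature.NumberTheory.GaloisRepresentations.DiscreteGaloisModule
open Summit.BirchSwinnertonDyer.BirchSwinnertonDyer.Theorems
open Summit.BirchSwinnertonDyer.BirchSwinnertonDyer.Theorems.UniversalToricDescentTwinControlGlue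
open Summit.BirchSwinnertonDyer.BirchSwinnertonDyer.Theorems.UniversalToricDescentTwinHowardConclusion

namespace Summit.BirchSwinnertonDyer.BirchSwinnertonDyer.Theorems.UniversalToricDescentTwinBoundedIndexGlue

/-! ## §1 The bounded-index glue at a fixed prime `p` -/

set_option maxHeartbeats 2400000 in
set_option synthInstance.maxHeartbeats 80000 in
/-- **Witnesses on the free rank-one frame `(Λ, ⊤)` from Howard's conclusion and non-divisible control images.**  If (B5) holds at
`p` on the twin frame (`Stmt.readoutIndexMultAt p`; (B4) is `readoutSelmerMultAt_holds p`), the control images of `z` are not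
`T^j`-divisible (`hndiv`) and Howard's conclusion holds at the control levels of `z` for all large `m`, then
`HasSpecWitnesses p Λ X.X ⊤` for every dual datum `X`: at `q_m` (`m > j`, `m ≫ 0`) the witness is x9's turnkey
`nonempty_specWitness_of_dvrConclusion_of_readout` with `S := Λ`, `L := ⊤`, `f := (r ↦ r • f̂_m z)`, `κ₁ := f̂_m z`
(`H_m = H¹_{F_𝔮}(K, T_𝔮)` free of rank one by Conclusion (i), so `#(H_m ⧸ Λ f̂_m z) ≤ p^j`,
`IwasawaAlgebra.finite_quotient_and_natCard_le_of_not_mem_X_pow_smul`), the discrete side VERBATIM x10b's.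
[cite: Howard2004HeegnerKolyvagin, Thm. 1.6.1, Prop. 2.2.8 and proof of Thm. 2.2.10 (𝔮 = T^m + p)]
[cite: GreenbergLNM1716, Prop. 2.4 and §4 p. 98] [cite: MastellaZerman2026, Thm. 2.40] -/
theorem hasSpecWitnesses_top_of_conclusion_of_notDivisible {p : ℕ} [Fact p.Prime] (hB5 : Stmt.readoutIndexMultAt p)
    (N : ℕ) [NeZero N] (W : WeierstrassCurve ℚ) [W.IsElliptic] [W.IsGloballyMinimal]
    (K : Type) [Field K] [NumberField K] (κ : ZpExtension K p) (γ : Field.absoluteGaloisGroup K)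
    (hK : IsImaginaryQuadratic K) (hp2 : p ≠ 2) (hκ : κ.IsAnticyclotomic) (hHeeg : SatisfiesHeegnerHypothesis N K)
    (hγ : κ.IsTopGenerator γ) (hE : ∀ Q : (W.baseChange K).toAffine.Point, p • Q = 0 → Q = 0)
    (hmultp : ∀ v : IsDedekindDomain.HeightOneSpectrum (NumberField.RingOfIntegers K),
      ((p : ℕ) : NumberField.RingOfIntegers K) ∈ v.asIdeal → (W.baseChange K).HasMultiplicativeReductionAt v)
    (D : (W.baseChange K).LambdaAdicSelmerData κ γ) (X : (W.baseChange K).SelmerDualData κ γ) (z : D.S)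
    {j : ℕ}
    (hndiv : ∀ (m : ℕ) (hm : 1 ≤ m), j ≤ m →
      ∀ (t : ∀ k, ((W.baseChange K).torsionGaloisModule ((p : ℤ) ^ (k + 1))).toContRepresentation →ⁱL
          ((W.baseChange K).torsionGaloisModule ((p : ℤ) ^ k)).toContRepresentation)
        (ht : ∀ k (P : geomTorsion (W.baseChange K) ((p : ℤ) ^ (k + 1))), t k P = (W.baseChange K).geomTorsionReduce p k P)
        (I : ZpExtension.EisensteinH1Data (κ.unitTwist (-1)) (fun k ↦ (W.baseChange K).torsionGaloisModule ((p : ℤ) ^ k)) t hm),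
        D.toEisensteinH1Linear hm t ht I hγ hE z ∉
          (Ideal.span {(PowerSeries.X : IwasawaAlgebra p) ^ j} • ⊤ : Submodule (IwasawaAlgebra p) I.H))
    (hconc : Stmt.conclusionAtControlLevels p N W K κ γ hγ hE D z) :
    HeegnerMuPartStabilized.HasSpecWitnesses p (IwasawaAlgebra p) X.X
      (⊤ : Submodule (IwasawaAlgebra p) (IwasawaAlgebra p)) := by
  -- the m-UNIFORM constants: (B4), (B5), Howard's conclusion
  obtain ⟨m₄, hSelAll⟩ := readoutSelmerMultAt_holds p N W K κ γ hK hp2 hκ hHeeg hγ hE hmultp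
  obtain ⟨c₂, m₃, hIdxAll⟩ := hB5 N W K κ γ hK hp2 hκ hHeeg hγ hE hmultp
  obtain ⟨m₀, hc⟩ := hconc
  refine ⟨max j c₂, j + 1 + m₀ + m₃ + m₄, fun m hmle ↦ ?_⟩
  have hm : 1 ≤ m := by omega
  have hjm : j < m := by omega
  have hm₀m : m₀ ≤ m := by omega
  have hm₃m : m₃ ≤ m := by omega
  have hm₄m : m₄ ≤ m := by omega
  have hppos : 0 < p := (Fact.out : p.Prime).pos
  letI := IwasawaAlgebra.isDomain_quotient_X_pow_add_C p hm
  letI := IwasawaAlgebra.isDiscreteValuationRing_quotient_X_pow_add_C p hm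
  haveI := IwasawaAlgebra.EisensteinCoeff.isLocalRing_succ p hm
  letI := IwasawaAlgebra.EisensteinCoeff.algebraOfSpecSucc p m
  haveI := W.isScalarTower_algebraOfSpecSucc (K := K) (p := p) (m := m)
  letI := W.residueModuleSucc (K := K) (p := p) hm
  -- Howard's conclusion at this `m`: the admissible Eisenstein datum, H.0–H.5 and the Conclusion
  obtain ⟨S, hpS, hbad, hSN, hSσ, L, hL, hLS, jbar', cd, Dd, fs, t, ht, I, hy, hconc⟩ := hc m hm hm₀m
  -- the control image of `z` at this `m` is not `T^j`-divisible (for THIS `t, ht, I`)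
  have hnd := hndiv m hm hjm.le t ht I
  obtain rfl := PrintX10bCompactControl.eq_torsionGaloisModuleReduce t ht
  have ht' : ∀ k, Function.Surjective ((W.baseChange K).torsionGaloisModuleReduce p k) :=
    fun k ↦ (W.baseChange K).torsionGaloisModuleReduce_surjective p k
  -- the four bookkeeping proofs of the readout
  have hπ₀ : (W.eisensteinDVRSetting (κ.unitTwist (-1)) hm S hpS hbad L hL hLS jbar' cd Dd fs).π ∈ IsLocalRing.maximalIdeal (IwasawaAlgebra p ⧸ Ideal.span {(PowerSeries.X ^ m + PowerSeries.C (p : ℤ_[p]) : IwasawaAlgebra p)}) := by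
    rw [hy.unif]; exact Ideal.mem_span_singleton_self _
  have he₀ : ∀ k, (W.eisensteinDVRSetting (κ.unitTwist (-1)) hm S hpS hbad L hL hLS jbar' cd Dd fs).e k ≤ (W.eisensteinDVRSetting (κ.unitTwist (-1)) hm S hpS hbad L hL hLS jbar' cd Dd fs).e (k + 1) := fun k ↦ (hy.e_strictMono (Nat.lt_succ_self k)).le
  have hπX : (W.eisensteinDVRSetting (κ.unitTwist (-1)) hm S hpS hbad L hL hLS jbar' cd Dd fs).π = Ideal.Quotient.mk (Ideal.span {(PowerSeries.X ^ m + PowerSeries.C (p : ℤ_[p]) : IwasawaAlgebra p)}) PowerSeries.X := rfl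
  have hek : ∀ k, (W.eisensteinDVRSetting (κ.unitTwist (-1)) hm S hpS hbad L hL hLS jbar' cd Dd fs).e (k + 1) - (W.eisensteinDVRSetting (κ.unitTwist (-1)) hm S hpS hbad L hL hLS jbar' cd Dd fs).e k = m := by
    intro k
    rw [W.eisensteinDVRSetting_e, W.eisensteinDVRSetting_e, Nat.mul_succ, Nat.add_sub_cancel_left]
  -- (B4), (B5) at this `m` and datum
  have hSel := hSelAll m hm hm₄m S hpS hbad hSN hSσ L hL hLS jbar' cd Dd fs hy hπ₀ he₀ hπX hek
  obtain ⟨hfin, hidx⟩ := hIdxAll m hm hm₃m S hpS hbad hSN hSσ L hL hLS jbar' cd Dd fs hy hπ₀ he₀ hπX hek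
  -- the control image lies in the pinned `H¹_{F_𝔮}` (ORD-ASCENT, p661609)
  have hf := fun s ↦ LambdaAdicSelmerData.toEisensteinH1Linear_mem_ordinarySelmer_of_multiplicative D hm _ ht I hγ hE S
    (fun v hv ↦ WeierstrassCurve.mem_of_mem_badPlaces (p := p) S hpS hbad v hv) s hp2 hmultp
  -- the honest `S_m`-module `H := H¹_{F_𝔮}(K, T_𝔮)` (p658581)
  letI := (I.isTorsionBy_qm_submodule (I.selmerSubmodule ((κ.unitTwist (-1)).eisensteinSelmerStructure (fun k ↦ (W.baseChange K).torsionGaloisModule ((p : ℤ) ^ k)) (fun k ↦ (W.baseChange K).torsionGaloisModuleReduce p k) hm S (fun v _ ↦ (W.baseChange K).ordinaryFiltrationAt v (fun k ↦ (W.baseChange K).torsionGaloisModuleReduce p k) ht)) (fun k c x hx ↦ (κ.unitTwist (-1)).map_eisensteinTwistSMulHom_mem_selmerGroup (fun k ↦ (W.baseChange K).torsionGaloisModule ((p : ℤ) ^ k)) (fun k ↦ (W.baseChange K).torsionGaloisModuleReduce p k) hm S (fun v _ ↦ (W.baseChange K).ordinaryFiltrationAt v (fun k ↦ (W.baseChange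 K).torsionGaloisModuleReduce p k) ht) k c x hx))).module
  haveI := I.isScalarTower_qm_submodule (I.selmerSubmodule ((κ.unitTwist (-1)).eisensteinSelmerStructure (fun k ↦ (W.baseChange K).torsionGaloisModule ((p : ℤ) ^ k)) (fun k ↦ (W.baseChange K).torsionGaloisModuleReduce p k) hm S (fun v _ ↦ (W.baseChange K).ordinaryFiltrationAt v (fun k ↦ (W.baseChange K).torsionGaloisModuleReduce p k) ht)) (fun k c x hx ↦ (κ.unitTwist (-1)).map_eisensteinTwistSMulHom_mem_selmerGroup (fun k ↦ (W.baseChange K).torsionGaloisModule ((p : ℤ) ^ k)) (fun k ↦ (W.baseChange K).torsionGaloisModuleReduce p k) hm S (fun v _ ↦ (W.baseChange K).ordinaryFiltrationAt v (fun k ↦ (W.baseChange K).torsionGaloisModuleReduce p k) ht) k c x hx))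
  -- Howard's conclusion (i): an honest free rank-one generator of `H` through the glue
  have hconc' := hconc
  obtain ⟨x, hfree, -⟩ := hconc'
  obtain ⟨x₀, -, hx₀⟩ := IwasawaAlgebra.exists_bijective_toSpanSingleton_of_isFreeRankOneOn _ _ x hfree
    ((AddMonoidHom.pi (fun k ↦ I.proj (k + 1))).comp (I.selmerSubmodule ((κ.unitTwist (-1)).eisensteinSelmerStructure (fun k ↦ (W.baseChange K).torsionGaloisModule ((p : ℤ) ^ k)) (fun k ↦ (W.baseChange K).torsionGaloisModuleReduce p k) hm S (fun v _ ↦ (W.baseChange K).ordinaryFiltrationAt v (fun k ↦ (W.baseChange K).torsionGaloisModuleReduce p k) ht)) (fun k c x hx ↦ (κ.unitTwist (-1)).map_eisensteinTwistSMulHom_mem_selmerGroup (fun k ↦ (W.baseChange K).torsionGaloisModule ((p : ℤ) ^ k)) (fun k ↦ (W.baseChange K).torsionGaloisModuleReduce p k) hm S (fun v _ ↦ (W.baseChange K).ordinaryFiltrationAt v (fun k ↦ (W.baseChange K).torsionGaloisModuleReduce p k) ht) k c x hx)).subtype.toAddMonoidHom)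
    ((I.injective_projSucc ht').comp Subtype.val_injective)
    (fun y ↦ I.mem_limitSelmer_succ_iff_mem_range ht' S _ y)
    (fun r y ↦ I.projSucc_smul ht' (I.selmerSubmodule ((κ.unitTwist (-1)).eisensteinSelmerStructure (fun k ↦ (W.baseChange K).torsionGaloisModule ((p : ℤ) ^ k)) (fun k ↦ (W.baseChange K).torsionGaloisModuleReduce p k) hm S (fun v _ ↦ (W.baseChange K).ordinaryFiltrationAt v (fun k ↦ (W.baseChange K).torsionGaloisModuleReduce p k) ht)) (fun k c x hx ↦ (κ.unitTwist (-1)).map_eisensteinTwistSMulHom_mem_selmerGroup (fun k ↦ (W.baseChange K).torsionGaloisModule ((p : ℤ) ^ k)) (fun k ↦ (W.baseChange K).torsionGaloisModuleReduce p k) hm S (fun v _ ↦ (W.baseChange K).ordinaryFiltrationAt v (fun k ↦ (W.baseChange K).torsionGaloisModuleReduce p k) ht) k c x hx)) r y)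
  -- the compact side on the frame `(Λ, ⊤)`: `f := r ↦ r • f̂ z`, cokernel `H ⧸ Λ f̂ z` of order `≤ p^j`
  have hκ₁nd : (((D.toEisensteinH1Linear hm _ ht I hγ hE).codRestrict (I.selmerSubmodule ((κ.unitTwist (-1)).eisensteinSelmerStructure (fun k ↦ (W.baseChange K).torsionGaloisModule ((p : ℤ) ^ k)) (fun k ↦ (W.baseChange K).torsionGaloisModuleReduce p k) hm S (fun v _ ↦ (W.baseChange K).ordinaryFiltrationAt v (fun k ↦ (W.baseChange K).torsionGaloisModuleReduce p k) ht)) (fun k c x hx ↦ (κ.unitTwist (-1)).map_eisensteinTwistSMulHom_mem_selmerGroup (fun k ↦ (W.baseChange K).torsionGaloisModule ((p : ℤ) ^ k)) (fun k ↦ (W.baseChange K).torsionGaloisModuleReduce p k) hm S (fun v _ ↦ (W.baseChange K).ordinaryFiltrationAt v (fun k ↦ (W.baseChange K).torsionGaloisModuleReduce p k) ht) k c x hx)) hf) z) ∉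
      (Ideal.span {(PowerSeries.X : IwasawaAlgebra p) ^ j} • ⊤ : Submodule (IwasawaAlgebra p) ↥(I.selmerSubmodule ((κ.unitTwist (-1)).eisensteinSelmerStructure (fun k ↦ (W.baseChange K).torsionGaloisModule ((p : ℤ) ^ k)) (fun k ↦ (W.baseChange K).torsionGaloisModuleReduce p k) hm S (fun v _ ↦ (W.baseChange K).ordinaryFiltrationAt v (fun k ↦ (W.baseChange K).torsionGaloisModuleReduce p k) ht)) (fun k c x hx ↦ (κ.unitTwist (-1)).map_eisensteinTwistSMulHom_mem_selmerGroup (fun k ↦ (W.baseChange K).torsionGaloisModule ((p : ℤ) ^ k)) (fun k ↦ (W.baseChange K).torsionGaloisModuleReduce p k) hm S (fun v _ ↦ (W.baseChange K).ordinaryFiltrationAt v (fun k ↦ (W.baseChange K).torsionGaloisModuleReduce p k) ht) k c x hx))) :=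
    IwasawaAlgebra.not_mem_X_pow_smul_top_of_coe p (I.selmerSubmodule ((κ.unitTwist (-1)).eisensteinSelmerStructure (fun k ↦ (W.baseChange K).torsionGaloisModule ((p : ℤ) ^ k)) (fun k ↦ (W.baseChange K).torsionGaloisModuleReduce p k) hm S (fun v _ ↦ (W.baseChange K).ordinaryFiltrationAt v (fun k ↦ (W.baseChange K).torsionGaloisModuleReduce p k) ht)) (fun k c x hx ↦ (κ.unitTwist (-1)).map_eisensteinTwistSMulHom_mem_selmerGroup (fun k ↦ (W.baseChange K).torsionGaloisModule ((p : ℤ) ^ k)) (fun k ↦ (W.baseChange K).torsionGaloisModuleReduce p k) hm S (fun v _ ↦ (W.baseChange K).ordinaryFiltrationAt v (fun k ↦ (W.baseChange K).torsionGaloisModuleReduce p k) ht) k c x hx)) _ hnd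
  have hfz : D.toEisensteinH1Linear hm _ ht I hγ hE z ≠ 0 := by
    intro h0
    exact hnd (by rw [h0]; exact zero_mem _)
  have hmemr : (((D.toEisensteinH1Linear hm _ ht I hγ hE).codRestrict (I.selmerSubmodule ((κ.unitTwist (-1)).eisensteinSelmerStructure (fun k ↦ (W.baseChange K).torsionGaloisModule ((p : ℤ) ^ k)) (fun k ↦ (W.baseChange K).torsionGaloisModuleReduce p k) hm S (fun v _ ↦ (W.baseChange K).ordinaryFiltrationAt v (fun k ↦ (W.baseChange K).torsionGaloisModuleReduce p k) ht)) (fun k c x hx ↦ (κ.unitTwist (-1)).map_eisensteinTwistSMulHom_mem_selmerGroup (fun k ↦ (W.baseChange K).torsionGaloisModule ((p : ℤ) ^ k)) (fun k ↦ (W.baseChange K).torsionGaloisModuleReduce p k) hm S (fun v _ ↦ (W.baseChange K).ordinaryFiltrationAt v (fun k ↦ (W.baseChange K).torsionGaloisModuleReduce p k) ht) k c x hx)) hf) z) ∈ LinearMap.range (LinearMap.toSpanSingleton (IwasawaAlgebra p) ↥(I.selmerSubmodule ((κ.unitTwist (-1)).eisensteinSelmerStructure (fun k ↦ (W.baseChange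 K).torsionGaloisModule ((p : ℤ) ^ k)) (fun k ↦ (W.baseChange K).torsionGaloisModuleReduce p k) hm S (fun v _ ↦ (W.baseChange K).ordinaryFiltrationAt v (fun k ↦ (W.baseChange K).torsionGaloisModuleReduce p k) ht)) (fun k c x hx ↦ (κ.unitTwist (-1)).map_eisensteinTwistSMulHom_mem_selmerGroup (fun k ↦ (W.baseChange K).torsionGaloisModule ((p : ℤ) ^ k)) (fun k ↦ (W.baseChange K).torsionGaloisModuleReduce p k) hm S (fun v _ ↦ (W.baseChange K).ordinaryFiltrationAt v (fun k ↦ (W.baseChange K).torsionGaloisModuleReduce p k) ht) k c x hx)) (((D.toEisensteinH1Linear hm _ ht I hγ hE).codRestrict (I.selmerSubmodule ((κ.unitTwist (-1)).eisensteinSelmerStructure (fun k ↦ (W.baseChange K).torsionGaloisModule ((p : ℤ) ^ k)) (fun k ↦ (W.baseChange K).torsionGaloisModuleReduce p k) hm S (fun v _ ↦ (W.baseChange K).ordinaryFiltrationAt v (fun k ↦ (W.baseChange K).torsionGaloisModuleReduce p k) ht)) (fun k c x hx ↦ (κ.unitTwist (-1)).map_eisensteinTwistSMulHom_mem_selmerGroup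 (fun k ↦ (W.baseChange K).torsionGaloisModule ((p : ℤ) ^ k)) (fun k ↦ (W.baseChange K).torsionGaloisModuleReduce p k) hm S (fun v _ ↦ (W.baseChange K).ordinaryFiltrationAt v (fun k ↦ (W.baseChange K).torsionGaloisModuleReduce p k) ht) k c x hx)) hf) z)) :=
    LinearMap.mem_range.2 ⟨1, one_smul _ _⟩
  obtain ⟨hcoker, hcoker_le⟩ := IwasawaAlgebra.finite_quotient_and_natCard_le_of_not_mem_X_pow_smul p hm x₀ hx₀
    (LinearMap.range (LinearMap.toSpanSingleton (IwasawaAlgebra p) ↥(I.selmerSubmodule ((κ.unitTwist (-1)).eisensteinSelmerStructure (fun k ↦ (W.baseChange K).torsionGaloisModule ((p : ℤ) ^ k)) (fun k ↦ (W.baseChange K).torsionGaloisModuleReduce p k) hm S (fun v _ ↦ (W.baseChange K).ordinaryFiltrationAt v (fun k ↦ (W.baseChange K).torsionGaloisModuleReduce p k) ht)) (fun k c x hx ↦ (κ.unitTwist (-1)).map_eisensteinTwistSMulHom_mem_selmerGroup (fun k ↦ (W.baseChange K).torsionGaloisModule ((p : ℤ) ^ k)) (fun k ↦ (W.baseChange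 K).torsionGaloisModuleReduce p k) hm S (fun v _ ↦ (W.baseChange K).ordinaryFiltrationAt v (fun k ↦ (W.baseChange K).torsionGaloisModuleReduce p k) ht) k c x hx)) (((D.toEisensteinH1Linear hm _ ht I hγ hE).codRestrict (I.selmerSubmodule ((κ.unitTwist (-1)).eisensteinSelmerStructure (fun k ↦ (W.baseChange K).torsionGaloisModule ((p : ℤ) ^ k)) (fun k ↦ (W.baseChange K).torsionGaloisModuleReduce p k) hm S (fun v _ ↦ (W.baseChange K).ordinaryFiltrationAt v (fun k ↦ (W.baseChange K).torsionGaloisModuleReduce p k) ht)) (fun k c x hx ↦ (κ.unitTwist (-1)).map_eisensteinTwistSMulHom_mem_selmerGroup (fun k ↦ (W.baseChange K).torsionGaloisModule ((p : ℤ) ^ k)) (fun k ↦ (W.baseChange K).torsionGaloisModuleReduce p k) hm S (fun v _ ↦ (W.baseChange K).ordinaryFiltrationAt v (fun k ↦ (W.baseChange K).torsionGaloisModuleReduce p k) ht) k c x hx)) hf) z))) hmemr hjm hκ₁nd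
  have hL' : (⊤ : Submodule (IwasawaAlgebra p) (IwasawaAlgebra p)).map (LinearMap.toSpanSingleton (IwasawaAlgebra p) ↥(I.selmerSubmodule ((κ.unitTwist (-1)).eisensteinSelmerStructure (fun k ↦ (W.baseChange K).torsionGaloisModule ((p : ℤ) ^ k)) (fun k ↦ (W.baseChange K).torsionGaloisModuleReduce p k) hm S (fun v _ ↦ (W.baseChange K).ordinaryFiltrationAt v (fun k ↦ (W.baseChange K).torsionGaloisModuleReduce p k) ht)) (fun k c x hx ↦ (κ.unitTwist (-1)).map_eisensteinTwistSMulHom_mem_selmerGroup (fun k ↦ (W.baseChange K).torsionGaloisModule ((p : ℤ) ^ k)) (fun k ↦ (W.baseChange K).torsionGaloisModuleReduce p k) hm S (fun v _ ↦ (W.baseChange K).ordinaryFiltrationAt v (fun k ↦ (W.baseChange K).torsionGaloisModuleReduce p k) ht) k c x hx)) (((D.toEisensteinH1Linear hm _ ht I hγ hE).codRestrict (I.selmerSubmodule ((κ.unitTwist (-1)).eisensteinSelmerStructure (fun k ↦ (W.baseChange K).torsionGaloisModule ((p : ℤ) ^ k)) (fun k ↦ (W.baseChange K).torsionGaloisModuleReduce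 p k) hm S (fun v _ ↦ (W.baseChange K).ordinaryFiltrationAt v (fun k ↦ (W.baseChange K).torsionGaloisModuleReduce p k) ht)) (fun k c x hx ↦ (κ.unitTwist (-1)).map_eisensteinTwistSMulHom_mem_selmerGroup (fun k ↦ (W.baseChange K).torsionGaloisModule ((p : ℤ) ^ k)) (fun k ↦ (W.baseChange K).torsionGaloisModuleReduce p k) hm S (fun v _ ↦ (W.baseChange K).ordinaryFiltrationAt v (fun k ↦ (W.baseChange K).torsionGaloisModuleReduce p k) ht) k c x hx)) hf) z)) ≤
      (IwasawaAlgebra p) ∙ (((D.toEisensteinH1Linear hm _ ht I hγ hE).codRestrict (I.selmerSubmodule ((κ.unitTwist (-1)).eisensteinSelmerStructure (fun k ↦ (W.baseChange K).torsionGaloisModule ((p : ℤ) ^ k)) (fun k ↦ (W.baseChange K).torsionGaloisModuleReduce p k) hm S (fun v _ ↦ (W.baseChange K).ordinaryFiltrationAt v (fun k ↦ (W.baseChange K).torsionGaloisModuleReduce p k) ht)) (fun k c x hx ↦ (κ.unitTwist (-1)).map_eisensteinTwistSMulHom_mem_selmerGroup (fun k ↦ (W.baseChange K).torsionGaloisModule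 ((p : ℤ) ^ k)) (fun k ↦ (W.baseChange K).torsionGaloisModuleReduce p k) hm S (fun v _ ↦ (W.baseChange K).ordinaryFiltrationAt v (fun k ↦ (W.baseChange K).torsionGaloisModuleReduce p k) ht) k c x hx)) hf) z) := by
    rintro _ ⟨r, -, rfl⟩
    exact Submodule.mem_span_singleton.2 ⟨r, rfl⟩
  -- the discrete turnkey (p669215), with Howard's conclusion UNOPENED
  exact HeegnerMuPartStabilized.nonempty_specWitness_of_dvrConclusion_of_readout hm
    (⊤ : Submodule (IwasawaAlgebra p) (IwasawaAlgebra p)) (W.baseChange K) hγ X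
    (W.eisensteinDVRSetting (κ.unitTwist (-1)) hm S hpS hbad L hL hLS jbar' cd Dd fs) hy hπ₀ he₀
    (fun k ↦ I.proj (k + 1) (D.toEisensteinH1Linear hm _ ht I hγ hE z))
    (PrintX10bCompactControl.proj_succ_mem_limitSelmer_eisensteinDVRSetting W K p κ hm S hpS hbad L hL hLS jbar' cd
      Dd fs _ ht I (hf z))
    (PrintX10bCompactControl.proj_succ_ne_zero I ht' hfz) hconc
    ((AddMonoidHom.pi (fun k ↦ I.proj (k + 1))).comp (I.selmerSubmodule ((κ.unitTwist (-1)).eisensteinSelmerStructure (fun k ↦ (W.baseChange K).torsionGaloisModule ((p : ℤ) ^ k)) (fun k ↦ (W.baseChange K).torsionGaloisModuleReduce p k) hm S (fun v _ ↦ (W.baseChange K).ordinaryFiltrationAt v (fun k ↦ (W.baseChange K).torsionGaloisModuleReduce p k) ht)) (fun k c x hx ↦ (κ.unitTwist (-1)).map_eisensteinTwistSMulHom_mem_selmerGroup (fun k ↦ (W.baseChange K).torsionGaloisModule ((p : ℤ) ^ k)) (fun k ↦ (W.baseChange K).torsionGaloisModuleReduce p k) hm S (fun v _ ↦ (W.baseChange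 K).ordinaryFiltrationAt v (fun k ↦ (W.baseChange K).torsionGaloisModuleReduce p k) ht) k c x hx)).subtype.toAddMonoidHom)
    ((I.injective_projSucc ht').comp Subtype.val_injective)
    (fun y ↦ I.mem_limitSelmer_succ_iff_mem_range ht' S _ y)
    (fun r y ↦ I.projSucc_smul ht' (I.selmerSubmodule ((κ.unitTwist (-1)).eisensteinSelmerStructure (fun k ↦ (W.baseChange K).torsionGaloisModule ((p : ℤ) ^ k)) (fun k ↦ (W.baseChange K).torsionGaloisModuleReduce p k) hm S (fun v _ ↦ (W.baseChange K).ordinaryFiltrationAt v (fun k ↦ (W.baseChange K).torsionGaloisModuleReduce p k) ht)) (fun k c x hx ↦ (κ.unitTwist (-1)).map_eisensteinTwistSMulHom_mem_selmerGroup (fun k ↦ (W.baseChange K).torsionGaloisModule ((p : ℤ) ^ k)) (fun k ↦ (W.baseChange K).torsionGaloisModuleReduce p k) hm S (fun v _ ↦ (W.baseChange K).ordinaryFiltrationAt v (fun k ↦ (W.baseChange K).torsionGaloisModuleReduce p k) ht) k c x hx)) r y)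
    (LinearMap.toSpanSingleton (IwasawaAlgebra p) ↥(I.selmerSubmodule ((κ.unitTwist (-1)).eisensteinSelmerStructure (fun k ↦ (W.baseChange K).torsionGaloisModule ((p : ℤ) ^ k)) (fun k ↦ (W.baseChange K).torsionGaloisModuleReduce p k) hm S (fun v _ ↦ (W.baseChange K).ordinaryFiltrationAt v (fun k ↦ (W.baseChange K).torsionGaloisModuleReduce p k) ht)) (fun k c x hx ↦ (κ.unitTwist (-1)).map_eisensteinTwistSMulHom_mem_selmerGroup (fun k ↦ (W.baseChange K).torsionGaloisModule ((p : ℤ) ^ k)) (fun k ↦ (W.baseChange K).torsionGaloisModuleReduce p k) hm S (fun v _ ↦ (W.baseChange K).ordinaryFiltrationAt v (fun k ↦ (W.baseChange K).torsionGaloisModuleReduce p k) ht) k c x hx)) (((D.toEisensteinH1Linear hm _ ht I hγ hE).codRestrict (I.selmerSubmodule ((κ.unitTwist (-1)).eisensteinSelmerStructure (fun k ↦ (W.baseChange K).torsionGaloisModule ((p : ℤ) ^ k)) (fun k ↦ (W.baseChange K).torsionGaloisModuleReduce p k) hm S (fun v _ ↦ (W.baseChange K).ordinaryFiltrationAt v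 (fun k ↦ (W.baseChange K).torsionGaloisModuleReduce p k) ht)) (fun k c x hx ↦ (κ.unitTwist (-1)).map_eisensteinTwistSMulHom_mem_selmerGroup (fun k ↦ (W.baseChange K).torsionGaloisModule ((p : ℤ) ^ k)) (fun k ↦ (W.baseChange K).torsionGaloisModuleReduce p k) hm S (fun v _ ↦ (W.baseChange K).ordinaryFiltrationAt v (fun k ↦ (W.baseChange K).torsionGaloisModuleReduce p k) ht) k c x hx)) hf) z)) (((D.toEisensteinH1Linear hm _ ht I hγ hE).codRestrict (I.selmerSubmodule ((κ.unitTwist (-1)).eisensteinSelmerStructure (fun k ↦ (W.baseChange K).torsionGaloisModule ((p : ℤ) ^ k)) (fun k ↦ (W.baseChange K).torsionGaloisModuleReduce p k) hm S (fun v _ ↦ (W.baseChange K).ordinaryFiltrationAt v (fun k ↦ (W.baseChange K).torsionGaloisModuleReduce p k) ht)) (fun k c x hx ↦ (κ.unitTwist (-1)).map_eisensteinTwistSMulHom_mem_selmerGroup (fun k ↦ (W.baseChange K).torsionGaloisModule ((p : ℤ) ^ k)) (fun k ↦ (W.baseChange K).torsionGaloisModuleReduce p k) hm S (fun v _ ↦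 (W.baseChange K).ordinaryFiltrationAt v (fun k ↦ (W.baseChange K).torsionGaloisModuleReduce p k) ht) k c x hx)) hf) z) rfl hL'
    (p ^ max j c₂) hcoker (hcoker_le.trans (Nat.pow_le_pow_right hppos (le_max_left _ _)))
    (W.eisensteinTowerReadout κ hm (W.eisensteinDVRSetting (κ.unitTwist (-1)) hm S hpS hbad L hL hLS jbar' cd Dd fs).π (W.eisensteinDVRSetting (κ.unitTwist (-1)) hm S hpS hbad L hL hLS jbar' cd Dd fs).e hy.killed hy.ker_red hπ₀ he₀ hπX hek)
    ((W.baseChange K).conjH1 p κ.kerSubgroup γ) (fun _ ↦ rfl)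
    (fun j' cj ↦ W.eisensteinTowerReadout_of_scalarMapH1_mk_X κ hm (W.eisensteinDVRSetting (κ.unitTwist (-1)) hm S hpS hbad L hL hLS jbar' cd Dd fs).π (W.eisensteinDVRSetting (κ.unitTwist (-1)) hm S hpS hbad L hL hLS jbar' cd Dd fs).e hy.killed hy.ker_red hπ₀ he₀ hπX hek
      hγ _ (fun _ ↦ rfl) j' cj)
    hSel hfin (hidx.trans (Nat.pow_le_pow_right hppos (le_max_right _ _)))

/-- **`∃ C m₀, ∀ m ≥ m₀, #(X_tors ⧸ q_m X_tors) ≤ p^C`** from (B5) at `p`, `hndiv` and Howard's conclusion (`X` f.g.):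
`exists_card_bound_of_specWitnesses` on the frame `(Λ, ⊤)`, whose factor `#((Λ/⊤)/q_m)² = 1`.
[cite: Howard2004HeegnerKolyvagin, Thm. 1.6.1 and proof of Thm. 2.2.10 (𝔮 = T^m + p)] -/
theorem exists_natCard_torsion_quot_le_of_conclusion_of_notDivisible {p : ℕ} [Fact p.Prime]
    (hB5 : Stmt.readoutIndexMultAt p)
    (N : ℕ) [NeZero N] (W : WeierstrassCurve ℚ) [W.IsElliptic] [W.IsGloballyMinimal]
    (K : Type) [Field K] [NumberField K] (κ : ZpExtension K p) (γ : Field.absoluteGaloisGroup K)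
    (hK : IsImaginaryQuadratic K) (hp2 : p ≠ 2) (hκ : κ.IsAnticyclotomic) (hHeeg : SatisfiesHeegnerHypothesis N K)
    (hγ : κ.IsTopGenerator γ) (hE : ∀ Q : (W.baseChange K).toAffine.Point, p • Q = 0 → Q = 0)
    (hmultp : ∀ v : IsDedekindDomain.HeightOneSpectrum (NumberField.RingOfIntegers K),
      ((p : ℕ) : NumberField.RingOfIntegers K) ∈ v.asIdeal → (W.baseChange K).HasMultiplicativeReductionAt v)
    (D : (W.baseChange K).LambdaAdicSelmerData κ γ) (X : (W.baseChange K).SelmerDualData κ γ) (z : D.S)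
    [Module.Finite (IwasawaAlgebra p) X.X]
    {j : ℕ}
    (hndiv : ∀ (m : ℕ) (hm : 1 ≤ m), j ≤ m →
      ∀ (t : ∀ k, ((W.baseChange K).torsionGaloisModule ((p : ℤ) ^ (k + 1))).toContRepresentation →ⁱL
          ((W.baseChange K).torsionGaloisModule ((p : ℤ) ^ k)).toContRepresentation)
        (ht : ∀ k (P : geomTorsion (W.baseChange K) ((p : ℤ) ^ (k + 1))), t k P = (W.baseChange K).geomTorsionReduce p k P)
        (I : ZpExtension.EisensteinH1Data (κ.unitTwist (-1)) (fun k ↦ (W.baseChange K).torsionGaloisModule ((p : ℤ) ^ k)) t hm),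
        D.toEisensteinH1Linear hm t ht I hγ hE z ∉
          (Ideal.span {(PowerSeries.X : IwasawaAlgebra p) ^ j} • ⊤ : Submodule (IwasawaAlgebra p) I.H))
    (hconc : Stmt.conclusionAtControlLevels p N W K κ γ hγ hE D z) :
    ∃ C m₀ : ℕ, ∀ m : ℕ, m₀ ≤ m →
      Nat.card (↥(Submodule.torsion (IwasawaAlgebra p) X.X) ⧸
        (Ideal.span {(PowerSeries.X ^ m + PowerSeries.C (p : ℤ_[p]) : IwasawaAlgebra p)} • ⊤ :
          Submodule (IwasawaAlgebra p) ↥(Submodule.torsion (IwasawaAlgebra p) X.X))) ≤ p ^ C := by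
  have htop : Module.IsTorsion (IwasawaAlgebra p)
      (IwasawaAlgebra p ⧸ (⊤ : Submodule (IwasawaAlgebra p) (IwasawaAlgebra p))) := by
    intro x
    exact ⟨1, Subsingleton.elim _ _⟩
  obtain ⟨C, m₀, h⟩ := HeegnerMuPartStabilized.exists_card_bound_of_specWitnesses p
    (⊤ : Submodule (IwasawaAlgebra p) (IwasawaAlgebra p)) htop
    (hasSpecWitnesses_top_of_conclusion_of_notDivisible hB5 N W K κ γ hK hp2 hκ hHeeg hγ hE hmultp D X z hndiv hconc)
  refine ⟨C, m₀, fun m hm ↦ (h m hm).trans ?_⟩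
  rw [Nat.card_unique, one_pow, mul_one]

/-! ## §2 The twin at `p = 3`, in the binders of crux 24737 -/

/-- **The twin's bounded torsion index from Howard's conclusion and non-divisible control images**, in the binders of crux
24737 (`Rank1Residual.Mult W′ 3`, `ρ̄_{W′,3}` onto, `K` imaginary quadratic Heegner for `N′`, `κ` anticyclotomic, `γ` a topological
generator): for ANY `Λ`-adic Selmer datum `Dat` and class `z` whose control images are not `T^j`-divisible (`hndiv`; K1 at layer `k`
gives it with `j = 3^k`), Howard's conclusion at the control levels of `z` for all large `m` implies
`∃ C m₀, ∀ m ≥ m₀, #(X_tors ⧸ q_m X_tors) ≤ 3^C` for `X = (W′.baseChange K).selmerDualData κ hγ` — (B5) = `readoutIndexMultAt_three`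
(p765199), `E(K)[3] = 0` by `baseChange_noPTorsion_of_surjective`, multiplicative reduction above `3` from `Mult W′ 3`.
[cite: Howard2004HeegnerKolyvagin, Thm. 1.6.1 and proof of Thm. 2.2.10 (𝔮 = T^m + p)] [cite: GreenbergLNM1716, §1 p. 60] -/
theorem twin_natCard_torsion_quot_le_of_conclusion_of_notDivisible
    (W' : WeierstrassCurve ℚ) [W'.IsElliptic] [W'.IsGloballyMinimal] (N' : ℕ) [NeZero N']
    (K : Type) [Field K] [NumberField K]
    (hm3 : Rank1Residual.Mult W' 3) (hsurj : W'.HasSurjectiveModNGaloisRep 3) (hK : IsImaginaryQuadratic K)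
    (hH : SatisfiesHeegnerHypothesis N' K) (κ : ZpExtension K 3) (hκ : κ.IsAnticyclotomic)
    (γ : absoluteGaloisGroup K) [hγ : Fact (κ.IsTopGenerator γ)]
    (Dat : (W'.baseChange K).LambdaAdicSelmerData κ γ) (z : Dat.S) {j : ℕ}
    (hndiv : ∀ (m : ℕ) (hm : 1 ≤ m), j ≤ m →
      ∀ (t : ∀ k, ((W'.baseChange K).torsionGaloisModule ((3 : ℤ) ^ (k + 1))).toContRepresentation →ⁱL
          ((W'.baseChange K).torsionGaloisModule ((3 : ℤ) ^ k)).toContRepresentation)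
        (ht : ∀ k (P : geomTorsion (W'.baseChange K) ((3 : ℤ) ^ (k + 1))), t k P = (W'.baseChange K).geomTorsionReduce 3 k P)
        (I : ZpExtension.EisensteinH1Data (κ.unitTwist (-1)) (fun k ↦ (W'.baseChange K).torsionGaloisModule ((3 : ℤ) ^ k)) t hm),
        Dat.toEisensteinH1Linear hm t ht I hγ.out (UniversalToricDescentTowerTorsion.baseChange_noPTorsion_of_surjective W' 3 hsurj K hK) z ∉
          (Ideal.span {(PowerSeries.X : IwasawaAlgebra 3) ^ j} • ⊤ : Submodule (IwasawaAlgebra 3) I.H))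
    (hconc : Stmt.conclusionAtControlLevels 3 N' W' K κ γ hγ.out
      (UniversalToricDescentTowerTorsion.baseChange_noPTorsion_of_surjective W' 3 hsurj K hK) Dat z) :
    ∃ C m₀ : ℕ, ∀ m : ℕ, m₀ ≤ m →
      Nat.card (↥(Submodule.torsion (IwasawaAlgebra 3) ((W'.baseChange K).selmerDualData κ hγ.out).X) ⧸
        (Ideal.span {(PowerSeries.X ^ m + PowerSeries.C ((3 : ℕ) : ℤ_[3]) : IwasawaAlgebra 3)} • ⊤ :
          Submodule (IwasawaAlgebra 3) ↥(Submodule.torsion (IwasawaAlgebra 3)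
            ((W'.baseChange K).selmerDualData κ hγ.out).X))) ≤ 3 ^ C := by
  haveI : Module.Finite (IwasawaAlgebra 3) ((W'.baseChange K).selmerDualData κ hγ.out).X :=
    ((W'.baseChange K).selmerDualData κ hγ.out).module_finite_holds hγ.out
  exact exists_natCard_torsion_quot_le_of_conclusion_of_notDivisible
    UniversalToricDescentTwinReadoutIndex.readoutIndexMultAt_three N' W' K κ γ hK (by decide) hκ hH hγ.out
    (UniversalToricDescentTowerTorsion.baseChange_noPTorsion_of_surjective W' 3 hsurj K hK)
    (fun w hw ↦ UniversalToricDescentTwinTateLineAtThree.hasMultiplicativeReductionAt_baseChange_of_mult_three W' hm3 K w hw)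
    Dat _ z hndiv hconc

end Summit.BirchSwinnertonDyer.BirchSwinnertonDyer.Theorems.UniversalToricDescentTwinBoundedIndexGlue

end
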